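import Literature.Geometry.Lorentzian.KerrSchildTimeTranslation
import Literature.Geometry.Lorentzian.KerrDataEmbedding
import Literature.Geometry.Lorentzian.KerrSliceFacts
import Literature.Geometry.Lorentzian.KerrHyperboloidalLeaves
import Literature.Geometry.Lorentzian.CauchyDevelopmentComap
import Literature.Geometry.Lorentzian.DataEmbeddingNormalSmooth
import Literature.Geometry.Lorentzian.KerrConvergenceProofs
import Literature.Geometry.Lorentzian.MinkowskiCauchy
import Literature.Topology.FourManifolds.ClosedBallProofs
import HarnessLib

/-!
# K2b-5 `stub_marchingLemma`, brick 4: the Kerr data on a slice piece, embedded at level `σ` — line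
# `direct-method-on-the-cone` (crux `BondiBartnikRigidity`, stmt-FinalStateConjecture-10807)

The datum of one marching step.  For an open set `N ⊆ E3` of spatial points inside the Kerr–Schild
slice `Kerr.slice a M` (`0 ≤ M`), the sub-datum `D' = ι^*(Kerr.data M a M)` along the inclusion
`ι : N → Kerr.slice a M` (`InitialDataSet.comap`) is induced, in the Kerr star chart
`Kerr.spacetime M a M`, not only by the slice embedding `y ↦ (0, y)` (`Kerr.dataEmbedding`, re-based by
`DataEmbedding.comapAlong`) but by the LEVEL-`σ` EMBEDDING `j : y ↦ (σ, y)` with the normal of the same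
values `ν = Kerr.sliceNormal ∘ ι` (stationarity: `Kerr.pullbackBilin_timeTranslate`,
`Kerr.isFutureUnitNormal_timeTranslate`, `Kerr.secondFundamentalForm_timeTranslate`):

* `level_isSmoothEmbedding` (`j` = translation diffeomorphism ∘ slice embedding),
  `level_isFutureUnitNormal`, `level_induced_h`, `level_induced_k` — the four fields of a
  `DataEmbedding D'` with spacetime `Kerr.spacetime M a M` and embedding `j`
  (so that `⟨Kerr.spacetime M a M hM, j, …, ν, …⟩ : DataEmbedding D'` is available to every consumer);
* `level_mdifferentiableAt_normal` — the section `y ↦ (j y, ν y)` of `T(Kerr.region a M)` is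
  differentiable (the displayed hypothesis of `DataEmbedding.restrict`).

The maps `ι`, `j`, `ν` enter as variables with their defining equations.  References: O'Neill 1983,
Ch. 3, Prop. 3.59, Ch. 4, Lemma 4.4 [ONeill1983]; Kerr–Schild 1965, §2 [KerrSchild1965];
Dafermos–Rodnianski arXiv:0811.0354, §5.1 [DafermosRodnianski2008].  No definitions, no named facts.
-/

noncomputable section

-- D-0017: single-problem summit, `Summit.<S>.<S>.…` by design (cf. lakefile `weak.linter.dupNamespace`).
set_option linter.dupNamespace false
-- instance search through the nested operator types of the Kerr chart facts
set_option maxSynthPendingDepth 3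

open Set Filter Function Topology TopologicalSpace Bundle
open Literature.Geometry.Lorentzian
open scoped Manifold ContDiff Topology

namespace Summit.FinalStateConjecture.FinalStateConjecture.Theorems.BondiBartnikRigidity.DirectMethod

namespace KerrLevel

/-! ### The inclusion of a slice piece -/

section Inclusion

variable {a M : ℝ} {N : Opens E3} (hN : N ≤ Kerr.slice a M)

/-- The inclusion of an open slice piece into the slice is an open embedding. [folklore] -/
theorem isOpenEmbedding_inclusion : IsOpenEmbedding (Opens.inclusion hN : N → Kerr.slice a M) :=
  IsOpenEmbedding.of_comp _ (Kerr.slice a M).2.isOpenEmbedding_subtypeVal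
    (by exact N.2.isOpenEmbedding_subtypeVal)

/-- The inclusion of an open slice piece has injective (identity) differentials. [folklore] -/
theorem injective_mfderiv_inclusion (u : N) :
    Injective (mfderiv 𝓘(ℝ, E3) 𝓘(ℝ, E3) (Opens.inclusion hN : N → Kerr.slice a M) u) := by
  have hι : MDifferentiableAt 𝓘(ℝ, E3) 𝓘(ℝ, E3) (Opens.inclusion hN : N → Kerr.slice a M) u :=
    (contMDiff_inclusion (n := ∞) hN u).mdifferentiableAt (by simp)
  have hval : MDifferentiableAt 𝓘(ℝ, E3) 𝓘(ℝ, E3) (Subtype.val : Kerr.slice a M → E3) (Opens.inclusion hN u) :=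
    (contMDiff_subtype_val (n := ∞) _).mdifferentiableAt (by simp)
  have hcomp := mfderiv_comp u hval hι
  have hid : mfderiv 𝓘(ℝ, E3) 𝓘(ℝ, E3) ((Subtype.val : Kerr.slice a M → E3) ∘ Opens.inclusion hN) u =
      ContinuousLinearMap.id ℝ E3 := by
    rw [show ((Subtype.val : Kerr.slice a M → E3) ∘ Opens.inclusion hN) = (Subtype.val : N → E3) from rfl]
    exact mfderiv_subtypeVal u
  rw [hid] at hcomp
  intro v w hvw
  have := congrArg (mfderiv 𝓘(ℝ, E3) 𝓘(ℝ, E3) (Subtype.val : Kerr.slice a M → E3) (Opens.inclusion hN u)) hvw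
  rw [← ContinuousLinearMap.comp_apply, ← ContinuousLinearMap.comp_apply, ← hcomp] at this
  exact this

end Inclusion

/-! ### The level-`σ` embedding of a slice piece and its data -/

section Level

variable [Kerr.Facts] [Kerr.SliceFacts]

omit [Kerr.Facts] [Kerr.SliceFacts] in
/-- The level-`σ` embedding is the `σ ∂_{t*}`-translate of the slice embedding of the piece. [folklore] -/
theorem level_eq_translate {M a : ℝ} (σ : ℝ) {N : Opens E3} (hN : N ≤ Kerr.slice a M)
    {j : N → Kerr.region a M} (hj : ∀ y, (j y : E4) = E4.ofTimeSpace σ (y : E3)) (y : N) :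
    (j y : E4) = ((Kerr.sliceEmbed a M ∘ Opens.inclusion hN) y : E4) + σ • E4.basisVector 0 := by
  rw [hj, E4.ofTimeSpace_eq_smul_add, add_comm]
  rfl

/-- **The level-`σ` embedding `y ↦ (σ, y)` of a slice piece is a smooth embedding** of `N` into the Kerr
star chart (the slice embedding of the piece — `DataEmbedding.comapAlong` of `Kerr.dataEmbedding` —
followed by the translation diffeomorphism `x ↦ x + σ ∂_{t*}` of the chart). [cite: DafermosRodnianski2008, §5.1] -/
theorem level_isSmoothEmbedding {M a : ℝ} (hM : 0 ≤ M) (σ : ℝ) {N : Opens E3} [ConnectedSpace N]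
    (hN : N ≤ Kerr.slice a M) {j : N → Kerr.region a M} (hj : ∀ y, (j y : E4) = E4.ofTimeSpace σ (y : E3)) :
    Manifold.IsSmoothEmbedding 𝓘(ℝ, E3) 𝓘(ℝ, E4) ∞ j := by
  set 𝒮₀ := (Kerr.dataEmbedding M a M hM).comapAlong (Opens.inclusion hN) (contMDiff_inclusion hN)
    (injective_mfderiv_inclusion hN) (isOpenEmbedding_inclusion hN)
    (fun u => (Kerr.dataEmbedding M a M hM).mdifferentiableAt_embed_normal _) with h𝒮₀
  have hsm : ∀ c : ℝ, ContMDiff 𝓘(ℝ, E4) 𝓘(ℝ, E4) ∞ (fun x : Kerr.region a M =>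
      (⟨(x : E4) + c • E4.basisVector 0, Kerr.add_smul_basisVector_zero_mem_region x.2 c⟩ : Kerr.region a M)) := by
    intro c
    refine (ContMDiff.subtypeVal_comp_iff _ _).1 ?_
    exact ((contDiff_id.add contDiff_const).contMDiff).comp contMDiff_subtype_val
  let T : Diffeomorph 𝓘(ℝ, E4) 𝓘(ℝ, E4) (Kerr.region a M) (Kerr.region a M) ∞ :=
    { toFun := fun x => ⟨(x : E4) + σ • E4.basisVector 0, Kerr.add_smul_basisVector_zero_mem_region x.2 σ⟩
      invFun := fun x => ⟨(x : E4) + (-σ) • E4.basisVector 0, Kerr.add_smul_basisVector_zero_mem_region x.2 (-σ)⟩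
      left_inv := fun x => Subtype.ext (by simp [add_assoc])
      right_inv := fun x => Subtype.ext (by simp [add_assoc])
      contMDiff_toFun := hsm σ
      contMDiff_invFun := hsm (-σ) }
  have hjT : j = T ∘ 𝒮₀.embed := by
    funext y
    exact Subtype.ext (level_eq_translate σ hN hj y)
  rw [hjT]
  exact 𝒮₀.isSmoothEmbedding.diffeomorph_comp T

/-- **`ν = sliceNormal ∘ ι` is the future unit normal of the level-`σ` embedding** (the values of the
future unit normal are invariant under `t*`-translation, `Kerr.isFutureUnitNormal_timeTranslate`).
[cite: ONeill1983, Ch. 3, Prop. 3.59] -/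
theorem level_isFutureUnitNormal {M a : ℝ} (hM : 0 ≤ M) (σ : ℝ) {N : Opens E3} [ConnectedSpace N]
    (hN : N ≤ Kerr.slice a M) {j : N → Kerr.region a M} (hj : ∀ y, (j y : E4) = E4.ofTimeSpace σ (y : E3))
    {ν : NormalField 𝓘(ℝ, E4) j} (hν : ∀ y, ν y = Kerr.sliceNormal M a M (Opens.inclusion hN y)) :
    (Kerr.smoothMetric M a M).IsFutureUnitNormal 𝓘(ℝ, E3) ((Kerr.timeOrientation M a M hM).ofLE le_top) j ν := by
  set 𝒮₀ := (Kerr.dataEmbedding M a M hM).comapAlong (Opens.inclusion hN) (contMDiff_inclusion hN)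
    (injective_mfderiv_inclusion hN) (isOpenEmbedding_inclusion hN)
    (fun u => (Kerr.dataEmbedding M a M hM).mdifferentiableAt_embed_normal _) with h𝒮₀
  exact Kerr.isFutureUnitNormal_timeTranslate (f := 𝒮₀.embed) (f' := j) (level_eq_translate σ hN hj) hM
    (ν := 𝒮₀.normal) (ν' := ν) (fun y => hν y)
    (fun y => (𝒮₀.isSmoothEmbedding.contMDiff y).mdifferentiableAt (by simp)) 𝒮₀.isFutureUnitNormal

/-- **The level-`σ` embedding induces the metric of the sub-datum**: `j^* g_{M,a} = (ι^* Kerr.data).h`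
(`Kerr.pullbackBilin_timeTranslate` and the induced metric of the re-based slice embedding).
[cite: ONeill1983, Ch. 3, Prop. 3.59] -/
theorem level_induced_h {M a : ℝ} (hM : 0 ≤ M) (σ : ℝ) {N : Opens E3} [ConnectedSpace N]
    (hN : N ≤ Kerr.slice a M) {j : N → Kerr.region a M} (hj : ∀ y, (j y : E4) = E4.ofTimeSpace σ (y : E3))
    (y : N) :
    pullbackBilin (I := 𝓘(ℝ, E4)) (I' := 𝓘(ℝ, E3)) j (Kerr.smoothMetric M a M).val y =
      ((Kerr.data M a M hM).comap (Opens.inclusion hN) (contMDiff_inclusion hN)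
        (injective_mfderiv_inclusion hN)).h.inner y := by
  set 𝒮₀ := (Kerr.dataEmbedding M a M hM).comapAlong (Opens.inclusion hN) (contMDiff_inclusion hN)
    (injective_mfderiv_inclusion hN) (isOpenEmbedding_inclusion hN)
    (fun u => (Kerr.dataEmbedding M a M hM).mdifferentiableAt_embed_normal _) with h𝒮₀
  rw [Kerr.pullbackBilin_timeTranslate (f := 𝒮₀.embed) (f' := j) (level_eq_translate σ hN hj)
    ((𝒮₀.isSmoothEmbedding.contMDiff y).mdifferentiableAt (by simp))]
  exact 𝒮₀.induced_h y

omit [Kerr.Facts] [Kerr.SliceFacts] in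
/-- The total representative of `Kerr.sliceNormal` is differentiable at spatial points with `r > 0`
(`M ≥ 0`: the lapse factor `(1 + 2H)^{-1/2}` is smooth there). [cite: Cook2000, §3.2.2] -/
theorem differentiableAt_sliceNormalRep {M a : ℝ} (hM : 0 ≤ M) {w : E3}
    (hw : 0 < Kerr.radius a (E4.ofTimeSpace 0 w)) :
    DifferentiableAt ℝ (fun w : E3 => (√(1 + 2 * Kerr.scalarH M a (E4.ofTimeSpace 0 w)))⁻¹ •
      Kerr.timeVector M a (E4.ofTimeSpace 0 w)) w := by
  have h0 := ((E4.contDiff_ofTimeSpace 0 (n := 1)).differentiable one_ne_zero).differentiableAt (x := w)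
  have hH : DifferentiableAt ℝ (fun w : E3 => Kerr.scalarH M a (E4.ofTimeSpace 0 w)) w :=
    ((Kerr.contDiffAt_scalarH M a hw (n := 1)).differentiableAt one_ne_zero).comp w h0
  have hV : DifferentiableAt ℝ (fun w : E3 => Kerr.timeVector M a (E4.ofTimeSpace 0 w)) w :=
    ((Kerr.contDiffAt_timeVector M a hw (n := 1)).differentiableAt one_ne_zero).comp w h0
  have hpos : 0 < 1 + 2 * Kerr.scalarH M a (E4.ofTimeSpace 0 w) := by
    linarith [Kerr.scalarH_nonneg hM a (E4.ofTimeSpace 0 w)]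
  have hc : DifferentiableAt ℝ (fun w : E3 => (√(1 + 2 * Kerr.scalarH M a (E4.ofTimeSpace 0 w)))⁻¹) w :=
    (((hH.const_mul 2).const_add 1).sqrt hpos.ne').inv (Real.sqrt_pos.2 hpos).ne'
  exact hc.smul hV

/-- **The level-`σ` embedding induces the second fundamental form of the sub-datum**:
`K^{g}_{j, ν} = (ι^* Kerr.data).k` (`Kerr.secondFundamentalForm_timeTranslate` with the total
representatives `E4.ofTimeSpace 0` of the slice embedding and of `Kerr.sliceNormal`, and the second
fundamental form of the re-based slice embedding). [cite: ONeill1983, Ch. 4, Lemma 4.4] -/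
theorem level_induced_k {M a : ℝ} (hM : 0 ≤ M) (σ : ℝ) {N : Opens E3} [ConnectedSpace N]
    (hN : N ≤ Kerr.slice a M) {j : N → Kerr.region a M} (hj : ∀ y, (j y : E4) = E4.ofTimeSpace σ (y : E3))
    {ν : NormalField 𝓘(ℝ, E4) j} (hν : ∀ y, ν y = Kerr.sliceNormal M a M (Opens.inclusion hN y))
    [(Kerr.smoothMetric M a M).HasLeviCivita] (y : N) :
    (Kerr.smoothMetric M a M).secondFundamentalForm 𝓘(ℝ, E3) j ν y =
      ((Kerr.data M a M hM).comap (Opens.inclusion hN) (contMDiff_inclusion hN)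
        (injective_mfderiv_inclusion hN)).kBilin y := by
  set 𝒮₀ := (Kerr.dataEmbedding M a M hM).comapAlong (Opens.inclusion hN) (contMDiff_inclusion hN)
    (injective_mfderiv_inclusion hN) (isOpenEmbedding_inclusion hN)
    (fun u => (Kerr.dataEmbedding M a M hM).mdifferentiableAt_embed_normal _) with h𝒮₀
  haveI : 𝒮₀.metric.toPseudoRiemannianMetric.HasLeviCivita := ‹(Kerr.smoothMetric M a M).HasLeviCivita›
  have hw : 0 < Kerr.radius a (E4.ofTimeSpace 0 (y : E3)) :=
    Kerr.radius_pos_of_mem_region (Kerr.mem_slice_iff_ofTimeSpace_mem_region.1 (hN y.2))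
  rw [Kerr.secondFundamentalForm_timeTranslate (f := 𝒮₀.embed) (f' := j) (level_eq_translate σ hN hj)
    (Φ := E4.ofTimeSpace 0) (fun _ => rfl) (ν := 𝒮₀.normal) (ν' := ν)
    (N := fun w : E3 => (√(1 + 2 * Kerr.scalarH M a (E4.ofTimeSpace 0 w)))⁻¹ • Kerr.timeVector M a (E4.ofTimeSpace 0 w))
    (fun _ => rfl) (fun y => hν y)
    (((E4.contDiff_ofTimeSpace 0 (n := 1)).differentiable one_ne_zero).differentiableAt)
    (differentiableAt_sliceNormalRep hM hw)]
  exact 𝒮₀.induced_k y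

/-- **The section `y ↦ (j y, ν y)` of the tangent bundle of the chart is differentiable** (the level-`σ`
embedding with its normal IS a data embedding of the sub-datum, and the normal section of a data embedding
is smooth, `DataEmbedding.mdifferentiableAt_embed_normal`). [folklore] -/
theorem level_mdifferentiableAt_normal {M a : ℝ} (hM : 0 ≤ M) (σ : ℝ) {N : Opens E3} [ConnectedSpace N]
    (hN : N ≤ Kerr.slice a M) {j : N → Kerr.region a M} (hj : ∀ y, (j y : E4) = E4.ofTimeSpace σ (y : E3))
    {ν : NormalField 𝓘(ℝ, E4) j} (hν : ∀ y, ν y = Kerr.sliceNormal M a M (Opens.inclusion hN y)) (y : N) :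
    MDifferentiableAt 𝓘(ℝ, E3) 𝓘(ℝ, E4).tangent
      (fun x => (TotalSpace.mk' E4 (j x) (ν x) : TangentBundle 𝓘(ℝ, E4) (Kerr.region a M))) y := by
  let 𝒮 : DataEmbedding ((Kerr.data M a M hM).comap (Opens.inclusion hN) (contMDiff_inclusion hN)
      (injective_mfderiv_inclusion hN)) :=
    { toSpacetime := Kerr.spacetime M a M hM
      embed := j
      isSmoothEmbedding := level_isSmoothEmbedding hM σ hN hj
      normal := ν
      isFutureUnitNormal := level_isFutureUnitNormal hM σ hN hj hν
      induced_h := level_induced_h hM σ hN hj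
      induced_k := by
        intro inst y
        haveI : (Kerr.smoothMetric M a M).HasLeviCivita := inst
        exact level_induced_k hM σ hN hj hν y }
  exact 𝒮.mdifferentiableAt_embed_normal y

end Level

end KerrLevel

/-- **Registered bookkeeping sub-goal `stub_kerrSlicePieceInclusion` of the line** (brick of the landing of
K2b-5 `stub_marchingLemma`): the inclusion of an open slice piece `N ⊆ E3` into the Kerr–Schild slice is an
open embedding (anchor of this file, whose content is the level-`σ` data embedding of a slice piece,
`KerrLevel.level_isSmoothEmbedding` / `_isFutureUnitNormal` / `_induced_h` / `_induced_k`). [folklore] -/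
theorem stub_kerrSlicePieceInclusion : ∀ (a M : ℝ) (N : Opens E3) (hN : N ≤ Kerr.slice a M),
    IsOpenEmbedding (Opens.inclusion hN : N → Kerr.slice a M) :=
  fun _ _ _ hN => KerrLevel.isOpenEmbedding_inclusion hN

end Summit.FinalStateConjecture.FinalStateConjecture.Theorems.BondiBartnikRigidity.DirectMethod

end
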